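import Summits.BirchSwinnertonDyer.BirchSwinnertonDyer.Theorems.PrintX8VSCInputHondaSystem
import Summits.BirchSwinnertonDyer.BirchSwinnertonDyer.Theorems.PrintX8VSCInputLem59AllN
import Literature.NumberTheory.EllipticCurves.SkinnerUrban2014.PAdicUnitPeriodRatioProofs
import Literature.NumberTheory.EllipticCurves.AnalyticRankModularityProofs
import HarnessLib

/-!
# Route `PrintX8VSC` (print-keyed repair twin of `PrintX8VS`; born 2026-08-28T22:36Z), support item stmt-BirchSwinnertonDyer-23741
# `PublishedInputsX8Contra` — the seven-conjunct published bundle ⟸ FOUR displayed prints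
# {Modularity (`exists_isNewformOf`), Sprung 2012 Thm. 7.14, Sprung 2012 Thm. 7.16 (print-keyed), Mazur 1978 Cor. 4.1}; the other three
# conjuncts (Sprung 2012 Thm. 2.2, Sprung 2024 Lemma 5.9 all `N`, entire `L(E,s)`) are THEOREMS of the tree / consequences of Modularity

Cell `bsd-ssimc`, width seat `cruxlead-stmt-BirchSwinnertonDyer-19875-w3` (gen 10) under the 19875 LEAD; `--supports` stmt-BirchSwinnertonDyer-23741
`--as helper` (CONDITIONAL door: the item is a held pack and is not closed). The print-keyed twin of `PrintX8VSPublishedInputsX8CoreSlim*.lean`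
(INPUTS seat `bsd-inputs-honda-p1`). HONEST FRAMING: bookkeeping of the trust base; no new mathematics; BSD / K′ / C′ / MC′ untouched.

`PublishedInputsX8Contra := exists_isNewformOf ∧ thm22_exists_isHondaSystem ∧ thm714_… ∧ thm716_…_contra ∧ lem59AllN_… ∧
realPeriodRat_eq_unit_mul_plusPeriod_three ∧ hasEntireLFunction_rat`; here (ii) = `PrintX8VSCGlue.inputHondaSystem_holds` (23750), (v) =
`PrintX8VSCGlue.inputLem59AllN_holds` (23751), (vi) ⟸ Mazur 1978 Cor. 4.1 (`SkinnerUrban2014.realPeriodRat_eq_unit_mul_plusPeriod_three_of_mazur`,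
INPUTS row F6 ⟸ F7), (vii) ⟸ (i) (`WeierstrassCurve.hasEntireLFunction_rat_of_exists_isNewformOf`, row F3 ⟸ F2). So the DISPLAYED BASE of the
bundle on `PrintX8VSC` is {F2 Modularity, F14 Sprung Thm. 7.14, Sprung Thm. 7.16 print-keyed (aside 23537), F7 Mazur Cor. 4.1} — four
E-specific/classical prints, all XL, all «cite» on the INPUTS desk's list.

References: [DiamondShurman2005] Thm. 8.8.3; [BCDTJAMS2001] Thm. A; [Sprung2012] Thm. 2.2, Thm. 7.14, Thm. 7.16; [Sprung2024] Lemma 5.9, §5.2;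
[Mazur1978] Cor. 4.1; [GreenbergVatsal2000] §3 Rem. 3.4; route file `Theses/PrintX8VSC.lean` (rev 2, item 23741).
-/

set_option autoImplicit false
-- justification: the mandated namespace `Summit.BirchSwinnertonDyer.BirchSwinnertonDyer.Theorems`
-- (single-conjunct summit, Sub = Summit) repeats a segment by design (D-0017).
set_option linter.dupNamespace false

noncomputable section

namespace Summit.BirchSwinnertonDyer.BirchSwinnertonDyer.Theorems.PrintX8VSCGlue

open Literature Literature.NumberTheory.EllipticCurves Literature.NumberTheory.EllipticCurves.ModularForms
  Literature.NumberTheory.EllipticCurves.Sprung2012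
  Summit.BirchSwinnertonDyer.BirchSwinnertonDyer.Theorems
  Summit.BirchSwinnertonDyer.BirchSwinnertonDyer.Theses.PrintX8VSC

/-- **Item stmt-BirchSwinnertonDyer-23741 `PrintX8VSC.PublishedInputsX8Contra` ⟸ FOUR displayed prints**: Modularity (`hmodf`,
`exists_isNewformOf`), Sprung 2012 Thm. 7.14 (`h714`), Sprung 2012 Thm. 7.16 in print keying (`h716c`), Mazur 1978 Cor. 4.1 (`hM`); the Honda
system (Thm. 2.2) and Sprung 2024 Lemma 5.9 (all `N`) are tree theorems, the period unit at `3` follows from Mazur's corollary, and the entire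
continuation of `L(E,s)` from Modularity. CONDITIONAL door; the held pack is not closed by it. [cite: DiamondShurman2005, Thm. 8.8.3]
[cite: Sprung2012, Thm. 2.2 (p. 1487), Thm. 7.14 and Thm. 7.16 (p. 1504)] [cite: Sprung2024, Lemma 5.9] [cite: Mazur1978, Cor. 4.1]
[cite: GreenbergVatsal2000, §3, Remark 3.4] -/
theorem publishedInputsX8Contra_of_prints (hmodf : exists_isNewformOf) (h714 : thm714_sharpFlatSelmerDual_finite_torsion)
    (h716c : thm716_sharpFlatCharIdeal_divisibility_contra) (hM : mazur_not_dvd_maninConstant_of_odd) :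
    Theses.PrintX8VSC.PublishedInputsX8Contra :=
  ⟨hmodf, inputHondaSystem_holds, h714, h716c, inputLem59AllN_holds,
    SkinnerUrban2014.realPeriodRat_eq_unit_mul_plusPeriod_three_of_mazur hM,
    WeierstrassCurve.hasEntireLFunction_rat_of_exists_isNewformOf hmodf⟩

/-- The same with the route's own aside decls as binders (`InputNewform` / `InputSharpFlatTorsion` / `InputKatoSharpFlatDivisibilityContra` (aside 23537)
are `def … : Prop :=` aliases of the three E-specific prints): **`PublishedInputsX8Contra` ⟸ InputNewform ∧ InputSharpFlatTorsion ∧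
InputKatoSharpFlatDivisibilityContra ∧ Mazur 1978 Cor. 4.1.** CONDITIONAL door. [cite: Sprung2012, Thm. 7.14 and Thm. 7.16 (p. 1504)]
[cite: Mazur1978, Cor. 4.1] [cite: DiamondShurman2005, Thm. 8.8.3] -/
theorem publishedInputsX8Contra_of_asides (hmodf : Theses.PrintX8VSC.InputNewform) (h714 : Theses.PrintX8VSC.InputSharpFlatTorsion)
    (h716c : Theses.PrintX8VSC.InputKatoSharpFlatDivisibilityContra) (hM : mazur_not_dvd_maninConstant_of_odd) :
    Theses.PrintX8VSC.PublishedInputsX8Contra :=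
  publishedInputsX8Contra_of_prints hmodf h714 h716c hM

end Summit.BirchSwinnertonDyer.BirchSwinnertonDyer.Theorems.PrintX8VSCGlue

end
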